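import Summits.QuantumFields.YangMills.Theorems.IsotropyFromPowerCountingTemperedCurvatureMomentsOfBddRenormalisation
import Literature.MathematicalPhysics.QuantumLattice.TorusWilsonMarkov

/-!
# Crux `TemperedCurvatureMoments` (T, stmt-QuantumFields-17721) — ideator 1, round 1: first lemmas

Sketch file for the crux idea cards `markov-shielding` and `entropic-shielding`.
Everything here is a SIGNATURE (sorried); it only has to elaborate.

* `MesoTempered` / `temperedCurvatureMoments_of_meso` — the MESOSCOPIC REDUCTION: T follows from
  eventual-in-`k`, fixed-physical-scale temperedness of the TRUE renormalised density `c_kⁿ W_k` on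
  the inner half-box (witness: the true density truncated below a slowly vanishing physical
  separation `s_k` and outside the inner half-box; convergence on compactly supported off-diagonal
  tensors by the tie, on all Schwartz tensors by a uniform weighted-`L¹` bound).
* `shielding_abstract` — MARKOV SHIELDING: conditional independence given a sub-σ-algebra plus
  Hölder turns an `n`-point moment into one-point `Lⁿ` norms of conditional expectations.
* `shieldedCurvature`, `ShieldedMomentBound`, `mesoTempered_of_shieldedMomentBound` — the
  shielded renormalised curvature `g_{k,R}(y) = E[c_k(F(τ_y U) − m_k) | links outside the cube of
  radius R around y]` on Wilson's torus and the one-point bound CH_n that implies MESO(n).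
* `integral_sub_integral_le_of_subGamma_klDiv` — ENTROPIC SHIELDING: the Donsker–Varadhan /
  transport-entropy bound with the observable's own sub-gamma parameters.
-/

noncomputable section

-- tree-known workaround (cf. the imported support file)
attribute [-instance] SimplexCategory.instFintypeToTypeOrderHomFinHAddNatLenOfNat

namespace Summit.QuantumFields.YangMills.Cruxes.TemperedCurvatureMoments.IdeatorOne

open scoped BigOperators SchwartzMap ENNReal
open MeasureTheory Filter Topology ProbabilityTheory
open Literature.MathematicalPhysics.QuantumFieldTheory Literature.MathematicalPhysics.QuantumLattice
open Literature.MathematicalPhysics.AQFT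
open Literature.Probability.LatticeModels (box)
open Summit.QuantumFields.YangMills.Theorems.OSLegsFromFemtoAndGap (torusMoment)
open Summit.QuantumFields.YangMills.Theorems.CurvatureBoostCovariance.Negative
  (Tie W1 EightFrameRP PlanarCone)
open Summit.QuantumFields.YangMills.Theorems.NPointIsotropy.Negative (E4)
open Summit.QuantumFields.YangMills.Theses.IsotropyFromPowerCounting (TemperedCurvatureMoments)

variable {G : Type} [Group G] [TopologicalSpace G] [IsTopologicalGroup G] [CompactSpace G]
  [MeasurableSpace G] [BorelSpace G]

/-! ## (A) The mesoscopic reduction -/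

/-- **MESO(n)**: eventual (in `k`), fixed-physical-scale temperedness of the TRUE renormalised
moment density `c_kⁿ W_k` of degree `n`, on the INNER half-box `box 4 (L_k / 2)` (where torus
distances are honest `ℤ⁴` distances): `∃ C N, ∀ s ∈ (0,1], ∃ k₀, ∀ k ≥ k₀`, every injective
multi-site of the inner half-box with pairwise PHYSICAL separations `≥ s` has
`|c_kⁿ W_k(x)| ≤ C s^{-N}`.  No bound is asked below the scale `s`, none near the torus seam, and
`k₀` may depend on `s`. -/
def MesoTempered (r : LatticeRep G) (sch : SpeciesScheme (YMSpecies G)) (n : ℕ) : Prop :=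
  ∃ (C : ℝ) (N : ℕ), 0 < C ∧ ∀ s : ℝ, 0 < s → s ≤ 1 → ∃ k₀ : ℕ, ∀ k : ℕ, k₀ ≤ k →
    ∀ x : Fin n → Literature.Probability.LatticeModels.Site 4,
      (∀ i, x i ∈ box 4 (sch.L k / 2)) →
      (∀ i j, i ≠ j → s ≤ ‖sch.a k • siteToE (x i) - sch.a k • siteToE (x j)‖) →
        |(sch.c r.curvature k) ^ n *
            torusMoment r.ρ (sch.β k) (sch.L k) r.curvature.F (sch.m r.curvature k) x| ≤
          C * s⁻¹ ^ N

/-- **Mesoscopic reduction, pointwise in `(r, sch, S₁, n)`** (first lemma of card `markov-shielding`,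
claimed PROVABLE NOW): the tie (first clause of `W1`) and `MesoTempered r sch n` give the degree-`n`
conclusion of T verbatim.  Witness: `D_k x = c_kⁿ W_k x` if all `x i ∈ box 4 (L_k/2)` and all pairwise
physical separations are `≥ s_k` (a sequence `s_k ↓ 0` chosen so slowly that `k ≥ k₀(s)` for every
dyadic `s ≥ s_k`), else `0`.  Temperedness: by MESO at the dyadic scale below the actual minimal
separation.  Convergence: for compactly supported real tensors with SEPARATED supports the truncated
Riemann sum EQUALS `latticeSchwinger` eventually (supports inside the inner half-box, separation
`> s_k`), hence converges by the tie (`riemannSum_trueDensity_eq_latticeSchwinger`); general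
off-diagonal real tensors — including flat-touching ones (supports at distance zero, all derivatives
vanishing on the touching set) — by a 3ε step: smooth cut-off near the touching set and outside a large
ball (error `→ 0` in `𝓢` by flatness, so `S₁ n` follows by continuity) plus a bound, uniform in `k`, on the
truncated density's Riemann sums over the error tensor from temperedness of `D` and flatness (domination
as in the landed `stub_dominatedTieLimit`). -/
theorem temperedApproximants_of_mesoTempered (r : LatticeRep G) (sch : SpeciesScheme (YMSpecies G))
    (S₁ : SchwingerFamily E4) (htie : Tie r sch S₁) {n : ℕ} (hn : 0 < n)
    (hmeso : MesoTempered r sch n) :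
    ∃ (D : ℕ → (Fin n → Literature.Probability.LatticeModels.Site 4) → ℝ) (C : ℝ) (N k₀ : ℕ),
      0 < C ∧
      (∀ k : ℕ, k₀ ≤ k → ∀ x : Fin n → Literature.Probability.LatticeModels.Site 4,
        (∀ i, x i ∈ box 4 (sch.L k)) → Function.Injective x →
        |D k x| ≤ C * (1 + ‖fun i => sch.a k • siteToE (x i)‖) ^ N *
          (1 + ∑ i, ∑ j ∈ Finset.univ.erase i,
            ‖sch.a k • siteToE (x i) - sch.a k • siteToE (x j)‖⁻¹) ^ N) ∧
      ∀ (f : Fin n → SchwartzMap E4 ℝ) (F : SchwartzMap (Fin n → E4) ℂ),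
        IsTensorOf F (fun i => ofRealTest (f i)) → IsOffDiagonal F →
        Filter.Tendsto (fun k => (((sch.a k ^ 4) ^ n *
          ∑ x ∈ Fintype.piFinset
              (fun _ : Fin n => box 4 (sch.L k)),
            (∏ i, f i (sch.a k • siteToE (x i))) * D k x : ℝ) : ℂ)) Filter.atTop (nhds (S₁ n F)) := by
  sorry

/-- **T from MESO** (all `G, r, sch, S₁, n`): the crux BY NAME. -/
theorem temperedCurvatureMoments_of_meso
    (h : ∀ (G : Type) [Group G] [TopologicalSpace G] [IsTopologicalGroup G] [CompactSpace G]
      [MeasurableSpace G] [BorelSpace G], IsCompactSimpleLieGroup G →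
      ∀ (r : LatticeRep G) (sch : SpeciesScheme (YMSpecies G)) (S₁ : SchwingerFamily E4),
        W1 r sch S₁ → EightFrameRP S₁ → PlanarCone S₁ → ∀ n : ℕ, 0 < n → MesoTempered r sch n) :
    TemperedCurvatureMoments := by
  intro G _ _ _ _ _ _ hG r sch S₁ hW h8 hC n hn
  exact temperedApproximants_of_mesoTempered r sch S₁ hW.1 hn (h G hG r sch S₁ hW h8 hC n hn)

/-! ## (B) Markov shielding -/

/-- **Shielding inequality (abstract)**: if the `φ i` are conditionally independent given `m` in the
product sense, then `|E ∏ φ i| ≤ ∏ ‖E[φ i | m]‖_{Lⁿ}` (tower property + generalised Hölder with `n`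
exponents `n`). [folklore] -/
theorem shielding_abstract {Ω : Type*} {m m0 : MeasurableSpace Ω} (hm : m ≤ m0) (μ : Measure Ω)
    [IsProbabilityMeasure μ] {n : ℕ} (hn : 0 < n) (φ : Fin n → Ω → ℝ)
    (hφ : ∀ i, Integrable (φ i) μ) (hprod : Integrable (fun ω => ∏ i, φ i ω) μ)
    (hci : μ[(fun ω => ∏ i, φ i ω) | m] =ᵐ[μ] fun ω => ∏ i, (μ[φ i | m]) ω) :
    |∫ ω, ∏ i, φ i ω ∂μ| ≤ ∏ i, (∫ ω, |(μ[φ i | m]) ω| ^ n ∂μ) ^ ((n : ℝ)⁻¹) := by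
  sorry

/-- The links of Wilson's torus of side `2S+1` whose base point lies OUTSIDE the sup-cube of radius
`R` (lattice units) around the image of the `ℤ⁴`-site `y`: the EXTERIOR σ-algebra is
`cylinderEvents (exteriorLinks S R y)`. -/
def exteriorLinks (S R : ℕ) (y : Literature.Probability.LatticeModels.Site 4) :
    Set (Literature.MathematicalPhysics.QuantumFieldTheory.Edge 4 (2 * S + 1)) :=
  {ℓ | ¬ ∀ ν : Fin 4, (ℓ.1 ν - ((y ν : ℤ) : ZMod (2 * S + 1)) + (R : ZMod (2 * S + 1))).val ≤ 2 * R}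

/-- **The shielded renormalised curvature** `g_{R}(y) = E_{β,S}[c (F(τ_y Ũ) − m) | links outside the
cube of radius R around y]` under Wilson's torus measure (a function of the exterior links; by the
DLR/Markov property of the plaquette specification, `isGibbsMeasure_wilsonMeasure`, it reads only the
links of plaquettes touching the cube's boundary). -/
def shieldedCurvature (r : LatticeRep G) (β c m : ℝ) (S R : ℕ)
    (y : Literature.Probability.LatticeModels.Site 4) : GaugeConfig 4 (2 * S + 1) G → ℝ :=
  (wilsonMeasure (d := 4) (L := 2 * S + 1) r.ρ β)[(fun U : GaugeConfig 4 (2 * S + 1) G =>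
      c * (r.curvature.F (configShift (-y) (torusLift (2 * S + 1) U)) - m)) |
    cylinderEvents (exteriorLinks S R y)]

/-- **CH_n (shielded moment bound, mesoscopic)**: for every physical radius `ρ ∈ (0,1]`, EVENTUALLY
in `k`, the `Lⁿ(μ_k)`-norm of the shielded renormalised curvature at radius `⌊ρ/a_k⌋` is
`≤ C ρ^{-p}` at every site of the inner half-box (translation invariance makes the site irrelevant).
The one-point statement that card `markov-shielding` reduces T to. -/
def ShieldedMomentBound (r : LatticeRep G) (sch : SpeciesScheme (YMSpecies G)) (n : ℕ) : Prop :=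
  ∃ (C p : ℝ), 0 < C ∧ ∀ ρ : ℝ, 0 < ρ → ρ ≤ 1 → ∃ k₀ : ℕ, ∀ k : ℕ, k₀ ≤ k →
    ∀ y : Literature.Probability.LatticeModels.Site 4, y ∈ box 4 (sch.L k / 2) →
      (∫ U, |shieldedCurvature r (sch.β k) (sch.c r.curvature k) (sch.m r.curvature k) (sch.L k)
          ⌊ρ / sch.a k⌋₊ y U| ^ n ∂(wilsonMeasure (d := 4) (L := 2 * sch.L k + 1) r.ρ (sch.β k))) ^
        ((n : ℝ)⁻¹) ≤ C * ρ ^ (-p)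

/-- **MESO from CH** (Markov shielding on Wilson's torus): cubes of radius `R = ⌊s/(3a_k)⌋` around
`s`-separated sites are disjoint and no plaquette touches two of them, so by the DLR equations of the
plaquette specification the `φ i = c_k(F(τ_{x i}Ũ) − m_k)` are conditionally independent given the
exterior links; `shielding_abstract` and `ShieldedMomentBound` give `|c_kⁿW_k(x)| ≤ Cⁿ (s/3)^{-pn}`. -/
theorem mesoTempered_of_shieldedMomentBound (r : LatticeRep G) (sch : SpeciesScheme (YMSpecies G))
    {n : ℕ} (hn : 0 < n) (h : ShieldedMomentBound r sch n) : MesoTempered r sch n := by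
  sorry

/-! ## (C) Entropic shielding -/

/-- **Transport–entropy (Donsker–Varadhan) bound with the observable's own sub-gamma parameters**:
if `X` is sub-gamma `(v, b)` on the right tail under `Q` — `log E_Q e^{t(X − E_Q X)} ≤ v t²/(2(1 − b t))`
for `0 < t < 1/b` — and `P ≪ Q` has finite relative entropy, then
`E_P X − E_Q X ≤ √(2 v KL(P‖Q)) + b KL(P‖Q)`.  Applied fibrewise to `P = ` law of the central
plaquette given the exterior, `Q = ` its law, and multiplied by `c_k`, it bounds the shielded curvature
by the conditional relative entropy with `c_k √v` and `c_k b` of the natural UV size (first lemma of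
card `entropic-shielding`). [cite: BoucheronLugosiMassart2013, Lemma 4.18 and §2.4] -/
theorem integral_sub_integral_le_of_subGamma_klDiv {Ω : Type*} [MeasurableSpace Ω]
    (P Q : Measure Ω) [IsProbabilityMeasure P] [IsProbabilityMeasure Q] (hPQ : P ≪ Q)
    (X : Ω → ℝ) (hXP : Integrable X P) (hXQ : Integrable X Q) {v b : ℝ} (hv : 0 ≤ v) (hb : 0 ≤ b)
    (hsg : ∀ t : ℝ, 0 < t → b * t < 1 →
      Real.log (∫ ω, Real.exp (t * (X ω - ∫ ω', X ω' ∂Q)) ∂Q) ≤ v * t ^ 2 / (2 * (1 - b * t)))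
    (hKL : InformationTheory.klDiv P Q ≠ ∞) :
    (∫ ω, X ω ∂P) - (∫ ω, X ω ∂Q) ≤
      Real.sqrt (2 * v * (InformationTheory.klDiv P Q).toReal) +
        b * (InformationTheory.klDiv P Q).toReal := by
  sorry

/-- **Conditional relative entropy of the central plaquette given the exterior** (the quantity ID of
card `entropic-shielding` bounds): at exterior configuration `U`, the KL divergence of the conditional
law of `F(τ_y Ũ)` given `cylinderEvents (exteriorLinks S R y)` from its unconditional law.  Its
`μ`-mean is the mutual information `I(F(τ_y Ũ); exterior beyond R)`. -/
def exteriorKL (r : LatticeRep G) (β : ℝ) (S R : ℕ) (y : Literature.Probability.LatticeModels.Site 4)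
    [StandardBorelSpace (GaugeConfig 4 (2 * S + 1) G)] (U : GaugeConfig 4 (2 * S + 1) G) : ℝ≥0∞ :=
  let μ : Measure (GaugeConfig 4 (2 * S + 1) G) := wilsonMeasure (d := 4) (L := 2 * S + 1) r.ρ β
  let X : GaugeConfig 4 (2 * S + 1) G → ℝ := fun V =>
    r.curvature.F (configShift (-y) (torusLift (2 * S + 1) V))
  haveI : IsProbabilityMeasure μ :=
    isProbabilityMeasure_wilsonMeasure (d := 4) (L := 2 * S + 1) r.ρ r.continuous β
  InformationTheory.klDiv (((condExpKernel μ (cylinderEvents (exteriorLinks S R y))) U).map X)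
    (μ.map X)

end Summit.QuantumFields.YangMills.Cruxes.TemperedCurvatureMoments.IdeatorOne

end
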